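import Literature.RingTheory.Flat.FaithfullyFlatLevel
import Literature.RingTheory.Flat.FinitePresentationDescent
import Mathlib.RingTheory.FiniteStability
import Mathlib.RingTheory.IsTensorProduct
import Mathlib.RingTheory.TensorProduct.Maps
import HarnessLib

/-!
# Descent of finite presentation along faithfully flat maps of finite presentation (Stacks 02KK)

## Main results

* `finitePresentation_of_isPushout_of_faithfullyFlat`: the `IsPushout` form of the abstract core
  `finitePresentation_of_faithfullyFlat_surjective_tmul`.
* `finitePresentation_of_faithfullyFlat_of_finitePresentation` (**Stacks 02KK**): for ring maps
  `Λ → R → S` with `R → S` faithfully flat of finite presentation and `Λ → S` of finite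
  presentation, `Λ → R` is of finite presentation. Proof (The Stacks Project, Tags 034Y + 02KK):
  write `S = R[x]/(f)` and approximate by `P_T = T[x]/(f_T)` over the finitely generated subrings
  `T ⊆ R`; by `Idx.exists_faithfullyFlat_level` some `P_T` is faithfully flat over `T`; with
  `A₁ = (Λ ⊗_ℤ T)[y_c]` (finitely many `c ∈ R`) and `B₁ = A₁ ⊗_T P_T`, the square
  `A₁ → B₁, A₁ → R, S = B₁ ⊗_{A₁} R` satisfies the hypotheses of the abstract core.

## References

* [The Stacks Project, Tags 02KK, 034Y][StacksProject]
-/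

universe u

open TensorProduct

noncomputable section

namespace Literature.RingTheory.Flat

-- For `T = T′` the instance `Idx.algebra_P_of_le` competes with the `T`-algebra structure of
-- `P_T` used in `NoetherianApproximation`; only the latter is wanted in this file.
attribute [-instance] Idx.algebra_P_of_le

/-- **The abstract core in `IsPushout` form**: `Λ → A₁ → R`, `A₁` of finite presentation over
`Λ`, `B₁` faithfully flat of finite presentation over `A₁`, `S = B₁ ⊗_{A₁} R` (`Algebra.IsPushout`)
of finite presentation over `Λ` with `B₁ → S` surjective; then `R` is of finite presentation over
`Λ`. [cite: StacksProject, Tag 02KK] -/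
theorem finitePresentation_of_isPushout_of_faithfullyFlat {Λ A₁ R B₁ S : Type*} [CommRing Λ]
    [CommRing A₁] [CommRing R] [CommRing B₁] [CommRing S] [Algebra Λ A₁] [Algebra Λ R]
    [Algebra A₁ R] [IsScalarTower Λ A₁ R] [Algebra A₁ B₁] [Algebra Λ B₁] [IsScalarTower Λ A₁ B₁]
    [Algebra B₁ S] [Algebra R S] [Algebra A₁ S] [IsScalarTower A₁ B₁ S] [IsScalarTower A₁ R S]
    [Algebra Λ S] [IsScalarTower Λ B₁ S]
    [Algebra.IsPushout A₁ B₁ R S] [Algebra.FinitePresentation Λ A₁]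
    [Module.FaithfullyFlat A₁ B₁] [Algebra.FinitePresentation A₁ B₁]
    [Algebra.FinitePresentation Λ S] (hsurj : Function.Surjective (algebraMap B₁ S)) :
    Algebra.FinitePresentation Λ R := by
  let e : B₁ ⊗[A₁] R ≃ₐ[B₁] S := Algebra.IsPushout.equiv A₁ B₁ R S
  haveI : Algebra.FinitePresentation Λ (B₁ ⊗[A₁] R) :=
    Algebra.FinitePresentation.equiv (e.symm.restrictScalars Λ)
  refine finitePresentation_of_faithfullyFlat_surjective_tmul (Λ := Λ) (A₁ := A₁) (B₁ := B₁)
    fun z => ?_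
  obtain ⟨b, hb⟩ := hsurj (e z)
  refine ⟨b, e.injective ?_⟩
  rw [Algebra.IsPushout.equiv_tmul, map_one, mul_one]
  exact hb

/-- Images of polynomials with coefficients in a given set lie in a subalgebra containing the
images of the coefficients and of the variables. [folklore] -/
theorem _root_.MvPolynomial.aeval_mem_of_coeffs {σ K L : Type*} [CommRing K] [CommRing L]
    [Algebra K L] {Λ : Type*} [CommRing Λ] [Algebra Λ K] [Algebra Λ L] [IsScalarTower Λ K L]
    (B : Subalgebra Λ L) (v : σ → L) (hv : ∀ i, v i ∈ B) (p : MvPolynomial σ K)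
    (hp : ∀ c ∈ p.coeffs, algebraMap K L c ∈ B) : MvPolynomial.aeval v p ∈ B := by
  classical
  rw [MvPolynomial.as_sum p, map_sum]
  refine Subalgebra.sum_mem _ fun d hd => ?_
  rw [MvPolynomial.aeval_monomial]
  refine Subalgebra.mul_mem _ (hp _ (MvPolynomial.coeff_mem_coeffs d (MvPolynomial.mem_support_iff.mp hd))) ?_
  exact Subalgebra.prod_mem _ fun i _ => Subalgebra.pow_mem _ (hv i) _

set_option maxHeartbeats 1600000 in
set_option synthInstance.maxHeartbeats 200000 in
/-- **Finite presentation descends along faithfully flat ring maps of finite presentation**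
(The Stacks Project, Tag 02KK; EGA IV 11.3.16): for ring maps `Λ → R → S` with `R → S`
faithfully flat of finite presentation and `Λ → S` of finite presentation, `Λ → R` is of finite
presentation. [cite: StacksProject, Tag 02KK] -/
theorem finitePresentation_of_faithfullyFlat_of_finitePresentation (Λ R S : Type u) [CommRing Λ]
    [CommRing R] [CommRing S] [Algebra Λ R] [Algebra Λ S] [Algebra R S] [IsScalarTower Λ R S]
    [Module.FaithfullyFlat R S] [Algebra.FinitePresentation R S] [Algebra.FinitePresentation Λ S] :
    Algebra.FinitePresentation Λ R := by
  classical
  -- Stage A: a presentation `S ≅ R[x]/(g)`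
  obtain ⟨nn, φ, hφ, s, hs⟩ := (inferInstance : Algebra.FinitePresentation R S).out
  let g : Fin s.card → MvPolynomial (Fin nn) R :=
    fun i => (s.equivFin.symm i : MvPolynomial (Fin nn) R)
  have hrange : Set.range g = (s : Set (MvPolynomial (Fin nn) R)) := by
    ext a
    constructor
    · rintro ⟨i, rfl⟩
      exact (s.equivFin.symm i).2
    · intro ha
      exact ⟨s.equivFin ⟨a, ha⟩, by simp [g]⟩
  have hspan : Ideal.span (Set.range g) = RingHom.ker φ.toRingHom := by rw [hrange, hs]
  let e : Pinf g ≃ₐ[R] S :=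
    (Ideal.quotientEquivAlgOfEq R hspan).trans (Ideal.quotientKerAlgEquivOfSurjective hφ)
  haveI : Module.FaithfullyFlat R (Pinf g) :=
    Module.FaithfullyFlat.of_linearEquiv R S e.toLinearEquiv
  -- Stage B: a level `T` with `P_T` faithfully flat over `T`
  obtain ⟨mu, hmu⟩ := Idx.exists_faithfullyFlat_level (f := g)
  haveI := hmu
  haveI : Algebra.FinitePresentation ℤ mu.T :=
    (Algebra.FinitePresentation.of_finiteType (R := ℤ) (A := mu.T)).mp mu.finiteType
  -- Stage C: `A₀ = Λ ⊗_ℤ T → R`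
  let A₀ := Λ ⊗[ℤ] mu.T
  letI : Algebra mu.T A₀ := Algebra.TensorProduct.rightAlgebra
  let θ₀ : A₀ →ₐ[Λ] R :=
    Algebra.TensorProduct.lift (Algebra.ofId Λ R) (mu.T.val) fun _ _ => Commute.all _ _
  letI : Algebra A₀ R := θ₀.toRingHom.toAlgebra
  haveI : IsScalarTower Λ A₀ R := IsScalarTower.of_algebraMap_eq fun l => by
    change algebraMap Λ R l = θ₀ (l ⊗ₜ[ℤ] (1 : mu.T))
    rw [Algebra.TensorProduct.lift_tmul, map_one, mul_one]
    rfl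
  haveI : IsScalarTower mu.T A₀ R := IsScalarTower.of_algebraMap_eq fun t => by
    change (t : R) = θ₀ ((1 : Λ) ⊗ₜ[ℤ] t)
    rw [Algebra.TensorProduct.lift_tmul, map_one, one_mul]
    rfl
  -- the finitely many elements of `R` to adjoin
  obtain ⟨sS, hsS⟩ := (inferInstance : Algebra.FiniteType Λ S).out
  have hrep0 : ∀ x : S, ∃ p : MvPolynomial (Fin nn) R, e (Pinf.mk p) = x := fun x => by
    obtain ⟨y, rfl⟩ := e.surjective x
    obtain ⟨p, rfl⟩ := Pinf.mk_surjective (f := g) y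
    exact ⟨p, rfl⟩
  choose rep hrep using hrep0
  let E : Finset R := sS.biUnion fun x => (rep x).coeffs
  -- `A₁ = A₀[y_c : c ∈ E] → R`
  let A₁ := MvPolynomial (↥E) A₀
  let θ₁ : A₁ →ₐ[A₀] R := MvPolynomial.aeval fun c => (c : R)
  letI : Algebra A₁ R := θ₁.toRingHom.toAlgebra
  haveI : IsScalarTower A₀ A₁ R := IsScalarTower.of_algebraMap_eq fun a => (θ₁.commutes a).symm
  haveI : IsScalarTower Λ A₁ R := IsScalarTower.of_algebraMap_eq fun l => by
    rw [IsScalarTower.algebraMap_apply Λ A₀ A₁, ← IsScalarTower.algebraMap_apply A₀ A₁ R,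
      ← IsScalarTower.algebraMap_apply Λ A₀ R]
  haveI : IsScalarTower mu.T A₁ R := IsScalarTower.of_algebraMap_eq fun t => by
    rw [IsScalarTower.algebraMap_apply mu.T A₀ A₁, ← IsScalarTower.algebraMap_apply A₀ A₁ R,
      ← IsScalarTower.algebraMap_apply mu.T A₀ R]
  haveI : Algebra.FinitePresentation Λ A₁ := Algebra.FinitePresentation.trans Λ A₀ A₁
  -- Stage D: `(A₁ ⊗[mu.T] mu.P) = A₁ ⊗_T P_T`
  letI : CommRing (A₁ ⊗[mu.T] mu.P) :=
    Algebra.TensorProduct.instCommRing (R := mu.T) (A := A₁) (B := mu.P)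
  letI : Algebra mu.P (A₁ ⊗[mu.T] mu.P) := Algebra.TensorProduct.rightAlgebra
  haveI : Module.FaithfullyFlat A₁ (A₁ ⊗[mu.T] mu.P) :=
    @Module.FaithfullyFlat.instTensorProduct mu.T mu.P _ _ _ A₁ _ _ hmu
  haveI : Algebra.FinitePresentation A₁ (A₁ ⊗[mu.T] mu.P) :=
    @Algebra.FinitePresentation.baseChange mu.T _ mu.P _ _ A₁ _ _ (Idx.finitePresentation_P mu)
  -- Stage E: everything maps to `S`
  letI : Algebra A₁ S := ((algebraMap R S).comp (algebraMap A₁ R)).toAlgebra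
  haveI : IsScalarTower A₁ R S := IsScalarTower.of_algebraMap_eq fun _ => rfl
  haveI : IsScalarTower Λ A₁ S := IsScalarTower.of_algebraMap_eq fun l => by
    change algebraMap Λ S l = algebraMap R S (algebraMap A₁ R (algebraMap Λ A₁ l))
    rw [← IsScalarTower.algebraMap_apply Λ A₁ R, ← IsScalarTower.algebraMap_apply Λ R S]
  haveI : IsScalarTower mu.T A₁ S := IsScalarTower.of_algebraMap_eq fun t => by
    change algebraMap R S (t : R) = algebraMap R S (algebraMap A₁ R (algebraMap mu.T A₁ t))
    rw [← IsScalarTower.algebraMap_apply mu.T A₁ R]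
    rfl
  let ψ : mu.P →ₐ[mu.T] S := (e.restrictScalars mu.T).toAlgHom.comp mu.toPinf
  letI : Algebra mu.P S := ψ.toRingHom.toAlgebra
  haveI : IsScalarTower mu.T mu.P S := IsScalarTower.of_algebraMap_eq fun t => (ψ.commutes t).symm
  let χ : (A₁ ⊗[mu.T] mu.P) →ₐ[A₁] S :=
    Algebra.TensorProduct.lift (Algebra.ofId A₁ S) ψ fun _ _ => Commute.all _ _
  letI : Algebra (A₁ ⊗[mu.T] mu.P) S := χ.toRingHom.toAlgebra
  haveI : IsScalarTower A₁ (A₁ ⊗[mu.T] mu.P) S := IsScalarTower.of_algebraMap_eq fun a => (χ.commutes a).symm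
  have hχ_tmul : ∀ (a : A₁) (y : mu.P),
      algebraMap (A₁ ⊗[mu.T] mu.P) S (a ⊗ₜ[mu.T] y) = algebraMap A₁ S a * ψ y :=
    fun a y => Algebra.TensorProduct.lift_tmul _ _ _ a y
  haveI : IsScalarTower mu.P (A₁ ⊗[mu.T] mu.P) S := IsScalarTower.of_algebraMap_eq fun y => by
    change ψ y = algebraMap (A₁ ⊗[mu.T] mu.P) S ((1 : A₁) ⊗ₜ[mu.T] y)
    rw [hχ_tmul, map_one, one_mul]
  haveI : IsScalarTower mu.T (A₁ ⊗[mu.T] mu.P) S := IsScalarTower.of_algebraMap_eq fun t => by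
    change algebraMap mu.T S t = algebraMap (A₁ ⊗[mu.T] mu.P) S (algebraMap mu.T (A₁ ⊗[mu.T] mu.P) t)
    rw [Algebra.TensorProduct.algebraMap_apply (R := mu.T) (A := A₁) (B := mu.P) t, hχ_tmul, map_one,
      mul_one, ← IsScalarTower.algebraMap_apply mu.T A₁ S]
  haveI : IsScalarTower Λ (A₁ ⊗[mu.T] mu.P) S := IsScalarTower.of_algebraMap_eq fun l => by
    change algebraMap Λ S l = algebraMap (A₁ ⊗[mu.T] mu.P) S (algebraMap Λ (A₁ ⊗[mu.T] mu.P) l)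
    rw [IsScalarTower.algebraMap_apply Λ A₁ (A₁ ⊗[mu.T] mu.P), ← IsScalarTower.algebraMap_apply A₁ (A₁ ⊗[mu.T] mu.P) S,
      IsScalarTower.algebraMap_apply A₁ R S, ← IsScalarTower.algebraMap_apply Λ A₁ R,
      ← IsScalarTower.algebraMap_apply Λ R S]
  -- the pushout squares
  have hTRPS : Algebra.IsPushout mu.T R mu.P S :=
    Algebra.IsPushout.of_equiv (h := Idx.isPushout_Pinf mu) e (RingHom.ext fun y => rfl)
  haveI : Algebra.IsPushout A₁ (A₁ ⊗[mu.T] mu.P) R S :=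
    ((Algebra.IsPushout.comp_iff (R := mu.T) (S := A₁) (R' := mu.P) (S' := A₁ ⊗[mu.T] mu.P) (T := R)
      (T' := S)).mp hTRPS).symm
  -- Stage F: `(A₁ ⊗[mu.T] mu.P) → S` is surjective
  have hsurj : Function.Surjective (algebraMap (A₁ ⊗[mu.T] mu.P) S) := by
    let Bim : Subalgebra Λ S := (χ.restrictScalars Λ).range
    have hR : ∀ c : ↥E, algebraMap R S (c : R) ∈ Bim := fun c => by
      rw [AlgHom.mem_range]
      refine ⟨MvPolynomial.X c ⊗ₜ[mu.T] (1 : mu.P), ?_⟩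
      change algebraMap (A₁ ⊗[mu.T] mu.P) S (MvPolynomial.X c ⊗ₜ[mu.T] (1 : mu.P)) = _
      rw [hχ_tmul, map_one, mul_one]
      change algebraMap R S (θ₁ (MvPolynomial.X c)) = _
      rw [MvPolynomial.aeval_X]
    have hX : ∀ i : Fin nn, e (Pinf.mk (MvPolynomial.X i)) ∈ Bim := fun i => by
      rw [AlgHom.mem_range]
      refine ⟨(1 : A₁) ⊗ₜ[mu.T] mu.mkP (MvPolynomial.X i), ?_⟩
      change algebraMap (A₁ ⊗[mu.T] mu.P) S ((1 : A₁) ⊗ₜ[mu.T] mu.mkP (MvPolynomial.X i)) = _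
      rw [hχ_tmul, map_one, one_mul]
      change e (mu.toPinf (mu.mkP (MvPolynomial.X i))) = _
      rw [Idx.toPinf_mkP, MvPolynomial.map_X]
    have hgen : ∀ x ∈ sS, x ∈ Bim := by
      intro x hx
      rw [← hrep x]
      have he : e (Pinf.mk (rep x)) =
          MvPolynomial.aeval (fun i => e (Pinf.mk (MvPolynomial.X i))) (rep x) := by
        have := MvPolynomial.aeval_unique ((e : Pinf g →ₐ[R] S).comp (Pinf.mk (f := g)))
        exact DFunLike.congr_fun this (rep x)
      rw [he]
      refine MvPolynomial.aeval_mem_of_coeffs Bim _ hX (rep x) fun c hc => ?_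
      have hcE : c ∈ E := Finset.mem_biUnion.mpr ⟨x, hx, hc⟩
      exact hR ⟨c, hcE⟩
    have htop : Bim = ⊤ := by
      rw [eq_top_iff, ← hsS, Algebra.adjoin_le_iff]
      exact fun x hx => hgen x hx
    intro z
    have hz : z ∈ Bim := htop ▸ Algebra.mem_top
    rw [AlgHom.mem_range] at hz
    obtain ⟨b, hb⟩ := hz
    exact ⟨b, hb⟩
  -- Stage G: the abstract core
  refine finitePresentation_of_isPushout_of_faithfullyFlat (Λ := Λ) (A₁ := A₁) (R := R)
    (B₁ := A₁ ⊗[mu.T] mu.P) (S := S) ?_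
  exact hsurj

end Literature.RingTheory.Flat

end
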